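/-
Copyright (c) 2026 the pub-hodgecm-mathlib formalisation cell (harness21).  Prover seat hodgecm-mathlib-LH4-p10 (g3): REF5 (g22) R5-122 (2)(b) on DEFS LEAF №1-R2 ★ p856987 —
the COVERED-SET BRIDGE with the weakened token hypothesis «token = 1 OR the axis is not read» (R-22 «κS-RECUT», heir LEAD F0P3a-plan (g19) T18-53).  2026-09-04.
-/
import Summits.HodgeConjecture.HodgeConjecture.Theorems.F0P3cDyRamFourFrameLawDefsR2   -- ★ DEFS LEAF №1-R2 (this seat, p856987): `OmegaSchedule`, `KappaSignLawAtS2∕AtR2 Ω`, `FourFrameLawsWildAtR2`; brings ★ №1-R, ★ №1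
import HarnessLib

/-!
# F0 · P3c · line LH4 «(D-RAM) FOUR-FRAME» — unit U3 §K-R2 (R-22): THE COVERED-SET BRIDGE OF THE Ω-AWARE κ-SIGN LAW, TOKEN = 1 **OR AXIS NOT READ**

Cell `pub/hodgecm-mathlib`, crux H413 = `stmt-HodgeConjecture-24833` (helper lane `--supports stmt-HodgeConjecture-24833 --as helper`), route HCCMUnconditional; THEOREMS ONLY
(no definition, no instance, no notation, no `sorry`), nothing asserted about any concrete token.

WHY (REF5 (g22) R5-122 (2)).  ★ №1-R2's bridge shape `kappaSignLawAtS2_iff_kappaSignLawAtS_of_forall_eq_one` asks the token to be `1` on EVERY admissible `(δ, a, b, n, i)` of the datum.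
For the glue-sign schedule of record `ΩR` this is dischargeable on the branch `2d ≤ t + 2` of the covered guard (root guard ⇒ level ≥ t + 1 ≥ 2d − 1 ⇒ ★ `glueSign_eq_one_of_v_sub_one_le`),
but NOT as written on the branch `d` odd, `d ≥ 3`: admissible axes at levels `d … 2d − 2` exist (e.g. `(d, t) = (3, 2)`, `a = −3 + 2√2 ∈ ℚ₂(√2)¹`, `ord_E(a − 1) = 3 < 5 = 2d − 1`) on which
`ΩR = 1` is at best junk and is not provable from the abstract datum — yet the LAW NEVER READS those axes: their parity datum gives `B ≤ 0`, so BOTH amplitudes `ampl q k B`,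
`ampl q k (B + τ d)` vanish and both laws state `X = 0` there.  Hence the right hypothesis is «`Ω = 1` OR both amplitudes of the axis are `0`», with the FULL binder telescope of the law
(datum, skew `δ`, roots under the root guard, element datum at `N₀ d`, `k` with `2k + d = Σn + 2`, slot `i`, parity datum `B`) available to the discharger:
* `kappaSignLawAtS2_iff_kappaSignLawAtS_of_forall_eq_one_or_ampl_eq_zero` (any `shift`), its R-level instance `kappaSignLawAtR2_iff_kappaSignLawAtR_of_forall_eq_one_or_ampl_eq_zero`
  (`shiftR`), and the fenced-conjunction twin `fourFrameLawsWildAtR2_iff_fourFrameLawsWildAtR_of_forall_eq_one_or_ampl_eq_zero`.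
The of-record discharge (LH4-p04 (g2), over its Ω-defs leaf): level(`c_i`) ≥ 2d − 1 → `Or.inl` (★ `glueSign_eq_one_of_v_sub_one_le`); else (forces `d` odd, `t = d − 1` by REF5's
`d_le_and_odd_iff_of_isRamifiedQuadraticDatum`) → `Or.inr` via `2B ≤ 1 ⇒ B ≤ 0` and ★ `ampl_eq_zero_of_nonpos` twice (`tauOfRecord d = −1`).
HONEST LABEL: HC_CM is proved only modulo the 7 printed citations (2 remaining: hLiu418 = stmt-HodgeConjecture-24832, h413 = stmt-HodgeConjecture-24833) until rung 0 closes;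
count-neutral (nothing asserted; the laws are census-law Props — prover targets, never literature facts).

## References
* [Rogawski1990] J. D. Rogawski, *Automorphic Representations of Unitary Groups in Three Variables*, Ann. of Math. Stud. 123 (1990): §4.9 Prop. 4.9.1 (a) p. 55, §4.10 p. 58.
* [LanglandsShelstad1987] R. P. Langlands, D. Shelstad, *On the definition of transfer factors*, Math. Ann. 278 (1987), §1.3, §3.
* [Serre1979] J.-P. Serre, *Local Fields*, GTM 67 (1979): Ch. V §3 Prop. 5, Cor. 3.
-/

set_option autoImplicit false

noncomputable section

namespace Summit.HodgeConjecture.HodgeConjecture.Cruxes.H413.F0P3cDyRamKappaSignLawR2Bridge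

open scoped Valued WithZero Matrix MatrixGroups
open Literature.NumberTheory.Automorphic Literature.NumberTheory.Automorphic.HermitianLattice
  Literature.NumberTheory.Automorphic.UnitaryLatticeTree Literature.NumberTheory.Automorphic.UnitaryThreeFourFrame
open Summit.HodgeConjecture.HodgeConjecture.Cruxes.H413.F0P3cDyRamFourFrameLawDefs
open Summit.HodgeConjecture.HodgeConjecture.Cruxes.H413.F0P3cDyRamFourFrameLawDefsR
open Summit.HodgeConjecture.HodgeConjecture.Cruxes.H413.F0P3cDyRamFourFrameLawDefsR2

variable {K : Type} [Field K] [Valued K ℤᵐ⁰] [CompleteSpace K] [Fintype 𝓀[K]]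

/-- **COVERED-SET BRIDGE, TOKEN = 1 OR AXIS NOT READ (any depth shift).**  If on every admissible `(δ, a, b, n₁, n₂, n₃, k, i, B)` of the datum — behind `IsRamifiedQuadraticDatum σ ϖ d t`,
`σ δ = −δ`, `δ ≠ 0`, `aσa = bσb = 1`, the root guard, the element datum at `N₀ d`, `2k + d = Σn + 2` and the parity datum `2B = n_i − d + 2 − 2·shift d t` — EITHER the token
`Ω K σ ϖ d a b i` is `1` OR both amplitudes `ampl q k B` and `ampl q k (B + τ d)` vanish, then the Ω-aware κ-sign cut IS the cut of ★ №1-R at that datum: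
`KappaSignLawAtS2 shift Ω N₀ τ σ ϖ d t ↔ KappaSignLawAtS shift N₀ τ σ ϖ d t`. [cite: LanglandsShelstad1987, §1.3] [cite: Rogawski1990, §4.9 Prop. 4.9.1 (a) p. 55] -/
theorem kappaSignLawAtS2_iff_kappaSignLawAtS_of_forall_eq_one_or_ampl_eq_zero (shift : ℕ → ℕ → ℤ) (Ω : OmegaSchedule) (N₀ : ℕ → ℕ) (τ : ℕ → ℤ)
    (σ : K →+* K) (ϖ : K) (d t : ℕ)
    (hΩ : ∀ (δ a b : K) (n₁ n₂ n₃ k : ℕ) (i : Fin 3) (B : ℤ), IsRamifiedQuadraticDatum σ ϖ d t → σ δ = -δ → δ ≠ 0 → a * σ a = 1 → b * σ b = 1 →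
      Valued.v (a - 1) < Valued.v (2 : K) → Valued.v (b - 1) < Valued.v (2 : K) → IsElementDatum σ ϖ (N₀ d) (a * a) (b * b) n₁ n₂ n₃ →
      2 * k + d = n₁ + n₂ + n₃ + 2 → 2 * B = ((![n₁, n₂, n₃] : Fin 3 → ℕ) i : ℤ) - d + 2 - 2 * shift d t →
      Ω K σ ϖ d a b i = 1 ∨ (ampl (Fintype.card 𝓀[K]) k B = 0 ∧ ampl (Fintype.card 𝓀[K]) k (B + τ d) = 0)) :
    KappaSignLawAtS2 shift Ω N₀ τ σ ϖ d t ↔ KappaSignLawAtS shift N₀ τ σ ϖ d t := by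
  constructor
  · intro h hD f hf δ hσδ hδ0 a b ha hb ha1 hb1 n₁ n₂ n₃ hE Γ hΓ k hk i B hB
    have key := h hD f hf δ hσδ hδ0 a b ha hb ha1 hb1 n₁ n₂ n₃ hE Γ hΓ k hk i B hB
    rcases hΩ δ a b n₁ n₂ n₃ k i B hD hσδ hδ0 ha hb ha1 hb1 hE hk hB with h1 | ⟨hA0, hA2⟩
    · rw [h1, one_mul] at key
      exact key
    · simp only [hA0, hA2, mul_zero] at key ⊢
      exact key
  · intro h hD f hf δ hσδ hδ0 a b ha hb ha1 hb1 n₁ n₂ n₃ hE Γ hΓ k hk i B hB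
    have key := h hD f hf δ hσδ hδ0 a b ha hb ha1 hb1 n₁ n₂ n₃ hE Γ hΓ k hk i B hB
    rcases hΩ δ a b n₁ n₂ n₃ k i B hD hσδ hδ0 ha hb ha1 hb1 hE hk hB with h1 | ⟨hA0, hA2⟩
    · rw [h1, one_mul]
      exact key
    · simp only [hA0, hA2, mul_zero] at key ⊢
      exact key

/-- **COVERED-SET BRIDGE AT THE RE-CUT SHIFT, TOKEN = 1 OR AXIS NOT READ**: under the same disjunctive hypothesis at `shiftR`,
`KappaSignLawAtR2 Ω N₀ τ σ ϖ d t ↔ KappaSignLawAtR N₀ τ σ ϖ d t` — the lemma LH4-p04 (g2)'s of-record discharge for `ΩR` feeds (guard `d % 2 = 1 ∨ 2 * d ≤ t + 2`: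
level ≥ 2d−1 ⇒ `Or.inl`; else `d` odd ⇒ `B ≤ 0` ⇒ `Or.inr` by ★ `ampl_eq_zero_of_nonpos`). [cite: LanglandsShelstad1987, §1.3] [cite: Serre1979, Ch. V §3 Prop. 5, Cor. 3] -/
theorem kappaSignLawAtR2_iff_kappaSignLawAtR_of_forall_eq_one_or_ampl_eq_zero (Ω : OmegaSchedule) (N₀ : ℕ → ℕ) (τ : ℕ → ℤ) (σ : K →+* K) (ϖ : K) (d t : ℕ)
    (hΩ : ∀ (δ a b : K) (n₁ n₂ n₃ k : ℕ) (i : Fin 3) (B : ℤ), IsRamifiedQuadraticDatum σ ϖ d t → σ δ = -δ → δ ≠ 0 → a * σ a = 1 → b * σ b = 1 →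
      Valued.v (a - 1) < Valued.v (2 : K) → Valued.v (b - 1) < Valued.v (2 : K) → IsElementDatum σ ϖ (N₀ d) (a * a) (b * b) n₁ n₂ n₃ →
      2 * k + d = n₁ + n₂ + n₃ + 2 → 2 * B = ((![n₁, n₂, n₃] : Fin 3 → ℕ) i : ℤ) - d + 2 - 2 * shiftR d t →
      Ω K σ ϖ d a b i = 1 ∨ (ampl (Fintype.card 𝓀[K]) k B = 0 ∧ ampl (Fintype.card 𝓀[K]) k (B + τ d) = 0)) :
    KappaSignLawAtR2 Ω N₀ τ σ ϖ d t ↔ KappaSignLawAtR N₀ τ σ ϖ d t :=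
  kappaSignLawAtS2_iff_kappaSignLawAtS_of_forall_eq_one_or_ampl_eq_zero shiftR Ω N₀ τ σ ϖ d t hΩ

/-- **COVERED-SET BRIDGE FOR THE FENCED CONJUNCTION, TOKEN = 1 OR AXIS NOT READ**: under the same hypothesis, `FourFrameLawsWildAtR2 Ω N₀ τ σ ϖ d t ↔ FourFrameLawsWildAtR N₀ τ σ ϖ d t`
(★ №1-R) — U4 ∕ tier-0 consumers of the sign conjunct keep today's currency through it. [cite: LanglandsShelstad1987, §1.3] [cite: Rogawski1990, §4.9 Prop. 4.9.1 (a) p. 55] -/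
theorem fourFrameLawsWildAtR2_iff_fourFrameLawsWildAtR_of_forall_eq_one_or_ampl_eq_zero (Ω : OmegaSchedule) (N₀ : ℕ → ℕ) (τ : ℕ → ℤ) (σ : K →+* K) (ϖ : K) (d t : ℕ)
    (hΩ : ∀ (δ a b : K) (n₁ n₂ n₃ k : ℕ) (i : Fin 3) (B : ℤ), IsRamifiedQuadraticDatum σ ϖ d t → σ δ = -δ → δ ≠ 0 → a * σ a = 1 → b * σ b = 1 →
      Valued.v (a - 1) < Valued.v (2 : K) → Valued.v (b - 1) < Valued.v (2 : K) → IsElementDatum σ ϖ (N₀ d) (a * a) (b * b) n₁ n₂ n₃ →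
      2 * k + d = n₁ + n₂ + n₃ + 2 → 2 * B = ((![n₁, n₂, n₃] : Fin 3 → ℕ) i : ℤ) - d + 2 - 2 * shiftR d t →
      Ω K σ ϖ d a b i = 1 ∨ (ampl (Fintype.card 𝓀[K]) k B = 0 ∧ ampl (Fintype.card 𝓀[K]) k (B + τ d) = 0)) :
    FourFrameLawsWildAtR2 Ω N₀ τ σ ϖ d t ↔ FourFrameLawsWildAtR N₀ τ σ ϖ d t := by
  have h := kappaSignLawAtR2_iff_kappaSignLawAtR_of_forall_eq_one_or_ampl_eq_zero Ω N₀ τ σ ϖ d t hΩ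
  constructor
  · intro hR2 h2
    obtain ⟨hS, hKA, hKS⟩ := hR2 h2
    exact ⟨hS, hKA, h.1 hKS⟩
  · intro hR h2
    obtain ⟨hS, hKA, hKS⟩ := hR h2
    exact ⟨hS, hKA, h.2 hKS⟩

end Summit.HodgeConjecture.HodgeConjecture.Cruxes.H413.F0P3cDyRamKappaSignLawR2Bridge

end
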